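import Summits.AtomisticToContinuum.BoseEinsteinCondensation.Theorems.BECConjugateDominationHardCoreExtensionNearMinTowerNecessity
import Summits.AtomisticToContinuum.BoseEinsteinCondensation.Theorems.BECConjugateDominationHardCoreExtensionNearMinTowerResidue
import Summits.AtomisticToContinuum.BoseEinsteinCondensation.Theorems.BECConjugateDominationHardCoreExtensionNearMinTowerAE
import Summits.AtomisticToContinuum.BoseEinsteinCondensation.Theorems.BECConjugateDominationHardCoreExtensionNearMinNormalForm
import Summits.AtomisticToContinuum.BoseEinsteinCondensation.Theorems.BECConjugateDominationHardCoreExtensionNearMinDirichletGoodMinorant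

/-!
# Line `near-minimiser-slack-transfer` — skeleton v3.6 (FINAL: every analytic piece LANDED; exactly ONE sorry = T★) (lead c7: truncation-tower reshape, ONE thermodynamic stub;
# composition, W-A and W-B LANDED and imported)
# for the crux `BECConjugateDomination.HardCoreExtension` (crux item stmt-AtomisticToContinuum-11786, rank 5,
# route `route-AtomisticToContinuum-BECConjugateDomination`)

Crux (FIXED, by name): `HardCoreExtension := A → BoseEinsteinCondensation`, `A` = dilute ground-state (Dirichlet) BEC for
every potential of the route's smooth class. Honest shape (Disproof §1/§5, leads c0–c6): `A` idle; the PERIODIC conjunct is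
proved per potential on the full admissible class and carried to the Dirichlet conjunct by the route's crux
`BoundaryTransferWeak` (stmt-0827) BY NAME, exactly as in the planner's v2 of this line and in every other line.

Mechanism (planner card `Ideas/near-minimiser-slack-transfer.md`, planner skeleton v2 `Lines/near-minimiser-slack-transfer.lean`):
SLACK MATCHING — the periodic trial class does not depend on the potential; if `w ≤ v` pointwise and
`E₀(v) ≤ E₀(w) + ε` at fixed `(N, L)`, every `ε`-near-minimiser of `v` is a `2ε`-near-minimiser of `w`
(`E_w Ψ ≤ E_v Ψ ≤ E₀(v) + ε ≤ E₀(w) + 2ε`). So near-minimiser condensation for the members of an approximating family of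
MINORANTS of `v`, with ONE slack serving the whole tail of the family, passes to `v`. No spectral data, no regularity, no
positivity, no simplicity, no connectivity.

v3 (lead c7, 2026-08-16) — RESHAPE of the planner's v2 {T `stub_uniformSmoothPeriodicBEC`, F `stub_slackUniformisation`,
A `stub_energyApproximation`}:
* the approximating family is the TRUNCATION TOWER `min(v, n)`, `n ∈ ℕ` (pointwise minorants, so clause (a) of A is free),
  whose clause (b) — fixed-volume energy convergence `E₀(v) ≤ E₀(min(v,n)) + ε` for all large `n` — is LANDED for EVERY
  admissible `v` (`stub_truncationEnergyConvergenceAll`, p121696, over `maxFormBound_of_isRepulsiveFiniteRange`): A is gone;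
* the slack is made level-uniform INSIDE the single thermodynamic stub (the planner's sanctioned bypass of F: "C⁺ … is all
  the transfer consumes — a lead who proves C⁺ in one piece may bypass F"): F is gone, and with it Lemma G (Disproof §13),
  which entered both surviving lines only through per-potential stability / simplicity of limit problems;
* ONE registered stub remains, **T★ `stub_nearMinimiserTowerBEC`**: for every admissible `v`, dilute near-minimiser periodic
  BEC along `min(v, n)` with `(ρ₀, c, N₀)` and, at each large `N`, the slack `δ` uniform in the level `n ≥ n₀(N)`.
  For BOUNDED `v` the tower is eventually constant and T★(v) IS `PeriodicBEC(v)` — the hypothesis of `BoundaryTransferWeak v`,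
  the route's own currency (target 11783 is its smooth-class instance) — see `nearMinimiserTowerBEC_iff_of_bounded`; for
  `hardCorePotential a` it is HEIGHT-UNIFORM SOFT-SPHERE near-minimiser BEC. BEC calibre; no worker-sized piece inside.
`HardCoreExtension_of hbt := hardCoreExtension_of_nearMinimiserTowerBEC stub_nearMinimiserTowerBEC hbt` — the composition is
LANDED (`Theorems/BECConjugateDominationHardCoreExtensionNearMinTower.lean`, p130512, 0 sorry) and imported here.

Smooth currency (v3.1: wave 1 LANDED — W-A `stub_towerEnergyConvergence` p130551, the (α') energy convergence for every
monotone measurable tower `wₙ ↑ v`; W-B `stub_smoothTowerHardCore` p130594, the explicit SMOOTH-CLASS tower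
`t·solidBump a ↑ hardCorePotential a`): `periodicBEC_of_smoothTowerBEC_hardCore` / `diluteBEC_hardSpheres_of_smoothTowerBEC`
are now sorry-free — height-uniform near-minimiser BEC along ONE explicit smooth-class family (target 11783's currency) +
`BoundaryTransferWeak` ⇒ hard-sphere BEC. Non-vacuity: `nearMinimiserTowerBEC_zero` (T★ at the free gas, `c = ½`).

STATE (v3.6 FINAL, 2026-08-16T23:55Z). Everything of the line except T★ is LANDED: p130512 `…NearMinTower` (composition; transfer),
p130551 `…TowerEnergyConvergence` (W-A), p130594 `…SmoothTowerHardCore` (W-B), p131028 `…NearMinTowerSmooth` (smooth currency, T★(0)),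
p131098 `…NearMinNormalForm` (crux in near-minimiser normal form), p131121 `…TowerNearMinLimit` (S-A), p131265 `…NearMinTowerAE`,
p131389 `…NearMinTowerNecessityCore`, p131809/p131988/p132352 `…MaxFormApproximationFiniteRange{Bookkeeping,Step,}` (S-B), p132636
`…NearMinTowerNecessity` (T★(v) ⟺ PeriodicBEC(v) for EVERY admissible `v`; (∀v T★ v) ⟺ `BECPeriodicReduction.PeriodicBEC` = stmt-0826 BY NAME;
hard-sphere BEC ⟺ height-uniform smooth-bump BEC), p131905 `…NearMinTowerResidue` (crux ⟸ stmt-0826 ∧ stmt-0827), p132022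
`…NearMinDirichletGoodMinorant` (Dirichlet-native BTW-free good-minorant criterion). Registered obligation of `HardCoreExtension_of`: ONLY T★.
STUCK: T★ — kernel-checked EQUIVALENT to the periodic conjunct (stmt-0826): thermodynamic-limit BEC (LSSY2005 Ch. 5 p. 42).

Disproof.lean (gen 4) honoured: §1 (`¬crux ↔ A ∧ ¬B`; antecedent idle — it must be); §3/`Negative.HighDensityObstruction`
(every statement dilute: `ρ < ρ₀(v)`, Ruelle finiteness below `ρ₁(v)`); §4 (no monotonicity of `λ_max`/`n₀` in `v` is
used — only inclusion of near-minimiser SETS at matched slack, §4b `windowInf_le_condensateNumber_of_le` is the ancestor);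
§7 (fixed-box degeneracy junk: T★ carries `∀ᶠ N` and the dilute guard; `δ = ⊤` makes T★'s inner clause false for `c > 0`,
so its provider takes `δ` finite — harmless, `∃ δ`); §10/§11 trichotomy (T★ quantifies over NEAR-minimisers of BOUNDED
potentials and tests the single `L²`-Lipschitz functional `condensateOccupation`: neither vacuous nor UV-false); §13 (Lemma G):
not used anywhere in this skeleton.
-/

noncomputable section

namespace Summit.AtomisticToContinuum.BoseEinsteinCondensation.Cruxes.HardCoreExtension.NearMinTower

open MeasureTheory Filter
open scoped ENNReal NNReal Topology
open Literature.MathematicalPhysics.QuantumManyBody.BoseGas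
open Summit.AtomisticToContinuum.BoseEinsteinCondensation.Theses.BECConjugateDomination

/-! ## The registered thermodynamic stub (the ONLY `sorry`; ⟺ `BECPeriodicReduction.PeriodicBEC` restricted to `v`, landed) -/

/-- Registered stub **T★ `stub_nearMinimiserTowerBEC`** (BEC calibre; the ONLY obligation of the composition).
For every repulsive finite-range `v` there is `ρ₀ > 0` such that for `0 < ρ < ρ₀` some `c > 0` satisfies: for all
large `N` there are a slack `δ > 0` and a level `n₀` such that for every level `n ≥ n₀`, every periodic trial state on
the torus of side `(N/ρ)^{1/3}` whose `min(v,n)`-energy is within `δ` of `E₀^per(min(v,n))` has constant-mode occupation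
`≥ cN`. Bounded `v`: literally `PeriodicBEC(v)` (`nearMinimiserTowerBEC_iff_of_bounded`). `hardCorePotential a`:
near-minimiser BEC of the soft spheres `n·1_{r<a}` uniformly in the height. `v = 0`: free gas, `c = ½`, `δ = N/(2CL²)`. -/
theorem stub_nearMinimiserTowerBEC :
    ∀ v : ℝ → ℝ≥0∞, IsRepulsiveFiniteRange v →
      ∃ ρ₀ : ℝ, 0 < ρ₀ ∧ ∀ ρ : ℝ, 0 < ρ → ρ < ρ₀ → ∃ c : ℝ, 0 < c ∧ ∀ᶠ N : ℕ in atTop,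
        ∃ δ : ℝ≥0∞, 0 < δ ∧ ∃ n₀ : ℕ, ∀ n : ℕ, n₀ ≤ n →
          ∀ Ψ : PeriodicTrialState N (sideLength ρ N),
            periodicEnergy (fun r => min (v r) (n : ℝ≥0∞)) Ψ ≤
                periodicGroundStateEnergy (fun r => min (v r) (n : ℝ≥0∞)) N (sideLength ρ N) + δ →
              ENNReal.ofReal (c * N) ≤ condensateOccupation N (sideLength ρ N) Ψ.ψ := by
  sorry

/-! ## The skeleton theorem -/

/-- **`HardCoreExtension` from the line `near-minimiser-slack-transfer`** (kernel-checked; no `sorry` of its own; the only open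
obligation is the registered stub T★ `stub_nearMinimiserTowerBEC`, kernel-checked EQUIVALENT to the periodic conjunct
`BECPeriodicReduction.PeriodicBEC` (stmt-0826) — `towerBECResidue_iff_PeriodicBEC`; `BoundaryTransferWeak` is the route item stmt-0827,
applied per potential as filed; the crux's own antecedent is not used: Disproof §1/§5). Everything else of the line is LANDED:
`…NearMinTower` p130512, `…TowerEnergyConvergence` p130551, `…SmoothTowerHardCore` p130594, `…NearMinTowerSmooth` p131028,
`…NearMinNormalForm` p131098, `…TowerNearMinLimit` p131121, `…NearMinTowerAE` p131265, `…NearMinTowerNecessityCore` p131389,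
`…MaxFormApproximationFiniteRange{Bookkeeping,Step,}` p131809/p131988/p132352 (S-B), `…NearMinTowerNecessity` p132636,
`…NearMinTowerResidue` p131905, `…NearMinDirichletGoodMinorant` p132022. -/
theorem HardCoreExtension_of (hbt : BoundaryTransferWeak) : HardCoreExtension :=
  hardCoreExtension_of_nearMinimiserTowerBEC stub_nearMinimiserTowerBEC hbt

/-- The same through the subsumption `hardCoreExtension_of_periodicBEC` (stmt-0826 ∧ stmt-0827 ⇒ crux) and the landed
`periodicBEC_of_towerBECResidue`: a second, equivalent reading of the skeleton. -/
example (hbt : BoundaryTransferWeak) : HardCoreExtension :=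
  hardCoreExtension_of_periodicBEC (periodicBEC_of_towerBECResidue stub_nearMinimiserTowerBEC) hbt

end Summit.AtomisticToContinuum.BoseEinsteinCondensation.Cruxes.HardCoreExtension.NearMinTower

end
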